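import Literature.AlgebraicGeometry.Modules.SerreTwistTheta
import Literature.AlgebraicGeometry.Modules.AffineLocalizing
import HarnessLib

/-!
# The graded kernel of `Θ`: the graded `P`-module relations among twisted sections, and the surjectivity of `Θ`

Continuation of `Modules/SerreTwistTheta`. For `ι : Z ⟶ 𝐏ʳ_A`, an `𝒪_Z`-module `G` and global sections
`g : J → Γ(Z, G(m₀))` (with the evaluation maps `Θ_{s,n} : (F_{X_s})_n → Γ(Z_s, G(n))`, `F = ⊕_j P(-m₀)`):

* `SerreTwist.kerTheta` — **the graded kernel `K ⊆ F = P^J`**: `w ∈ K` iff every homogeneous component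
  `w_n` satisfies `Θ_{∅,n}(w_n) = 0` in `Γ(Z, G(n))` (the relations among the `g_j`; the kernel of
  `F → Γ_*(G)`, Hartshorne II Prop. 5.15); it is a `P`-submodule (`comp_Theta_smul`) and graded
  (`isGraded_kerTheta`, for `LaurentCech.IsGraded`);
* `Theta_eq_zero_of_mem_locDeg_ker` — `(K_{X_s})_n ⊆ ker Θ_{s,n}`;
* `mem_locDeg_ker_of_Theta_eq_zero` — **`ker Θ_{s,n} ⊆ (K_{X_s})_n`** for `ι` affine and `G`
  affine-localizing (`Modules/AffineLocalizing`): a global section of `G(D)` vanishing on `Z_s` is killed by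
  a power of `x_s` (`exists_pow_smul_eq_zero_of_map_eq_zero`, the module form of
  `ProjCech.exists_pow_mul_eq_zero`: `Z_{s+i}` is the basic open of `t_{s,i}|_Z` in the affine `Z_i`);
The surjectivity of `Θ_{s,n}` (`s ≠ ∅`) and the resulting short exact sequence
`0 → Č_n(K) → Č_n(F) → Č(𝒰; G(n)) → 0` are in `Modules/SerreTwistCechComplex`.
Everything is proved; no named facts.

References: Hartshorne II Prop. 5.15, II Lemma 5.3, III Thm. 5.2 (proof); EGA III 2.2.1. [Hartshorne1977]
-/

noncomputable section

universe u

open CategoryTheory AlgebraicGeometry TopologicalSpace Opposite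
open Literature.Algebra.Homology Literature.Algebra.Homology.LaurentCech
open Literature.AlgebraicGeometry.Morphisms Literature.AlgebraicGeometry.Morphisms.ProjCech

attribute [local instance] MvPolynomial.gradedAlgebra
  Literature.AlgebraicGeometry.Motives.ProjBaseChange.algebraBase

namespace Literature.AlgebraicGeometry.Modules

namespace SerreTwist

variable {A : Type u} [CommRing A] {r : ℕ} {Z : Scheme.{u}} (ι : Z ⟶ PP A r) (G : Z.Modules)
variable {J : Type} [Fintype J] (m₀ : ℕ) (g : J → Γ(twistMod ι G m₀, ⊤))

/-! ## Homogeneous components (bookkeeping for the shift `cdeg J m₀ ≡ m₀`) -/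

omit [Fintype J] in
/-- Polynomial vectors have no poles: `ι(w) ∈ F_{X_s}` for every `s`. [folklore] -/
theorem ιK_mem_loc_top (s : Finset (Fin (r + 1))) (w : J → P A r) :
    ιK A r J w ∈ loc (⊤ : Submodule (P A r) (J → P A r)) s :=
  ⟨0, w, Submodule.mem_top, by rw [Nat.cast_zero, xs_zero, one_smul]⟩

omit [Fintype J] in
/-- The degree-`d` component of a polynomial vector lies in `(F_{X_s})_d`. [folklore] -/
theorem ιK_projDeg_mem_locDeg (s : Finset (Fin (r + 1))) (d : ℤ) (w : J → P A r) :
    ιK A r J (projDeg (cdeg J m₀) d w) ∈ locDeg (cdeg J m₀) (⊤ : Submodule (P A r) (J → P A r)) s d := by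
  refine ⟨ιK_mem_loc_top s _, ?_⟩
  rw [ιK_projDeg]
  exact KfilterDeg_mem_Kdeg _ d _

omit [Fintype J] in
/-- `projDeg` is idempotent: homogeneous components are homogeneous. [folklore] -/
theorem isHomog_projDeg (d : ℤ) (w : J → P A r) : IsHomog (cdeg J m₀) d (projDeg (cdeg J m₀) d w) := by
  apply ιK_injective
  rw [ιK_projDeg, ιK_projDeg, KfilterDeg_of_mem _ (KfilterDeg_mem_Kdeg _ d _)]

omit [Fintype J] in
/-- Components of different degrees: `(w_d)_n = 0` for `n ≠ d`. [folklore] -/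
theorem projDeg_projDeg_of_ne {n d : ℤ} (h : n ≠ d) (w : J → P A r) :
    projDeg (cdeg J m₀) n (projDeg (cdeg J m₀) d w) = 0 := by
  apply ιK_injective
  rw [ιK_projDeg, ιK_projDeg, KfilterDeg_of_mem_ne _ (KfilterDeg_mem_Kdeg _ d _) h, map_zero]

omit [Fintype J] in
/-- Polynomial vectors have no components of negative (shifted) degree. [folklore] -/
theorem projDeg_eq_zero_of_neg {d : ℤ} (hd : d < 0) (w : J → P A r) : projDeg (cdeg J m₀) d w = 0 := by
  funext j
  rw [projDeg_apply, hcomp_of_neg (show d - cdeg J m₀ j < 0 by simp only [cdeg]; omega)]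
  rfl

omit [Fintype J] in
/-- A homogeneous vector of degree `D` has `D`-component itself and all other components zero. [folklore] -/
theorem projDeg_of_isHomog {D : ℤ} {k : J → P A r} (hk : IsHomog (cdeg J m₀) D k) (n : ℤ) :
    projDeg (cdeg J m₀) n k = if n = D then k else 0 := by
  split_ifs with h
  · subst h; exact hk
  · rw [← hk, projDeg_projDeg_of_ne m₀ h]

omit [Fintype J] in
/-- `ι(x_s^N v) = ι(k)` with `v ∈ 𝕂_d` makes `k` homogeneous of degree `d + N #s`. [folklore] -/
theorem isHomog_of_xs_smul_eq {s : Finset (Fin (r + 1))} {N : ℕ} {d : ℤ} {v : J → L A r}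
    (hdeg : v ∈ Kdeg A r (cdeg J m₀) d) {k : J → P A r} (hk : xs A s N • v = ιK A r J k) :
    IsHomog (cdeg J m₀) (d + N * s.card) k := by
  rw [IsHomog, projDeg_eq_self_iff, ← hk]
  exact xs_smul_mem_Kdeg _ hdeg s N

/-! ## The graded kernel -/

/-- `Θ` of a vector only depends on the vector. [folklore] -/
theorem Theta_congr (s : Finset (Fin (r + 1))) (n : ℕ) {v w : J → L A r} (h : v = w) (hv : v ∈ Floc A J m₀ s n)
    (hw : w ∈ Floc A J m₀ s n) : Theta ι G m₀ g s n ⟨v, hv⟩ = Theta ι G m₀ g s n ⟨w, hw⟩ := by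
  subst h; rfl

/-- `Θ` of the zero vector (with any membership proof). [folklore] -/
theorem Theta_zero_mk (s : Finset (Fin (r + 1))) (n : ℕ) (h : (0 : J → L A r) ∈ Floc A J m₀ s n) :
    Theta ι G m₀ g s n ⟨0, h⟩ = 0 :=
  (Theta ι G m₀ g s n).map_zero

/-- **The graded kernel `K ⊆ P^J` of `Θ`**: the vectors all of whose homogeneous components `w_n` have
`Θ_{∅,n}(w_n) = 0 ∈ Γ(Z, G(n))` (the graded module of relations among the sections `g_j`). [folklore] -/
def kerTheta : Submodule (P A r) (J → P A r) where
  carrier := {w | ∀ n : ℕ, Theta ι G m₀ g ∅ n ⟨ιK A r J (projDeg (cdeg J m₀) n w), ιK_projDeg_mem_locDeg m₀ ∅ n w⟩ = 0}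
  zero_mem' n := by
    have h : ιK A r J (projDeg (cdeg J m₀) (n : ℤ) 0) = 0 := by rw [map_zero, map_zero]
    rw [Theta_congr ι G m₀ g ∅ n h _ (Submodule.zero_mem _)]
    exact Theta_zero_mk ι G m₀ g ∅ n _
  add_mem' {w w'} hw hw' n := by
    have h : ιK A r J (projDeg (cdeg J m₀) (n : ℤ) (w + w')) =
        ιK A r J (projDeg (cdeg J m₀) n w) + ιK A r J (projDeg (cdeg J m₀) n w') := by rw [map_add, map_add]
    rw [Theta_congr ι G m₀ g ∅ n h _ (add_mem (ιK_projDeg_mem_locDeg m₀ ∅ n w) (ιK_projDeg_mem_locDeg m₀ ∅ n w'))]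
    have := (Theta ι G m₀ g ∅ n).map_add ⟨_, ιK_projDeg_mem_locDeg m₀ ∅ n w⟩ ⟨_, ιK_projDeg_mem_locDeg m₀ ∅ n w'⟩
    rw [hw n, hw' n, add_zero] at this
    exact this
  smul_mem' p w hw n := by
    classical
    -- the summands of `(p w)_n = Σ_d p_{n-d} w_d`
    let x : ℤ → (J → L A r) := fun d => toL A r (hcomp ((n : ℤ) - d) p) • ιK A r J (projDeg (cdeg J m₀) d w)
    have hx : ∀ d, x d ∈ Floc A J m₀ ∅ n := fun d =>
      smul_mem_Floc m₀ (by ring) (toL_mem_Adm_of_mem_Ldeg ∅ (toL_hcomp_mem_Ldeg _ p)) (ιK_projDeg_mem_locDeg m₀ ∅ d w)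
    have hsum : ιK A r J (projDeg (cdeg J m₀) (n : ℤ) (p • w)) = ∑ d ∈ degSet (cdeg J m₀) w, x d := by
      conv_lhs => rw [← sum_projDeg (cdeg J m₀) w, Finset.smul_sum, map_sum, map_sum]
      refine Finset.sum_congr rfl fun d _ => ?_
      change ιK A r J (projDeg (cdeg J m₀) (n : ℤ) (p • projDeg (cdeg J m₀) d w)) =
        toL A r (hcomp ((n : ℤ) - d) p) • ιK A r J (projDeg (cdeg J m₀) d w)
      rw [projDeg_smul_of_isHomog _ (isHomog_projDeg m₀ d w), ιK_smul]
    have hx0 : ∀ d, Theta ι G m₀ g ∅ n ⟨x d, hx d⟩ = 0 := by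
      intro d
      cases d with
      | ofNat d =>
        refine twistMod_ext ι G fun i => ?_
        have h : comp ι G (Theta ι G m₀ g ∅ n ⟨x (Int.ofNat d), hx (Int.ofNat d)⟩) i =
            twFun ι ∅ i ((n : ℤ) - d) (toL A r (hcomp ((n : ℤ) - d) p))
              (toL_mem_Adm_of_mem_Ldeg ∅ (toL_hcomp_mem_Ldeg _ p)) •
              comp ι G (Theta ι G m₀ g ∅ d ⟨ιK A r J (projDeg (cdeg J m₀) d w), ιK_projDeg_mem_locDeg m₀ ∅ d w⟩) i :=
          comp_Theta_smul ι G m₀ g (n := d) (n' := n) (c := (n : ℤ) - d) (by ring)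
            (toL_mem_Adm_of_mem_Ldeg ∅ (toL_hcomp_mem_Ldeg _ p)) _ (ιK_projDeg_mem_locDeg m₀ ∅ d w) (hx d) i
        rw [h, hw d]
        exact smul_zero _
      | negSucc d =>
        have h0 : x (Int.negSucc d) = 0 := by
          change toL A r _ • ιK A r J (projDeg (cdeg J m₀) (Int.negSucc d) w) = 0
          rw [projDeg_eq_zero_of_neg m₀ (Int.negSucc_lt_zero d), map_zero, smul_zero]
        rw [Theta_congr ι G m₀ g ∅ n h0 _ (Submodule.zero_mem _)]
        exact Theta_zero_mk ι G m₀ g ∅ n _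
    have hmem : (∑ d ∈ degSet (cdeg J m₀) w, x d) ∈ Floc A J m₀ ∅ n := Submodule.sum_mem _ fun d _ => hx d
    rw [Theta_congr ι G m₀ g ∅ n hsum _ hmem]
    have heq : (⟨∑ d ∈ degSet (cdeg J m₀) w, x d, hmem⟩ : Floc A J m₀ ∅ n) =
        ∑ d ∈ degSet (cdeg J m₀) w, ⟨x d, hx d⟩ := by
      apply Subtype.ext
      rw [Submodule.coe_sum]
    rw [heq, map_sum]
    exact Finset.sum_eq_zero fun d _ => hx0 d

/-- Membership in the graded kernel. [folklore] -/
theorem mem_kerTheta_iff {w : J → P A r} :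
    w ∈ kerTheta ι G m₀ g ↔
      ∀ n : ℕ, Theta ι G m₀ g ∅ n ⟨ιK A r J (projDeg (cdeg J m₀) n w), ιK_projDeg_mem_locDeg m₀ ∅ n w⟩ = 0 :=
  Iff.rfl

/-- A homogeneous polynomial vector of degree `D ∈ ℕ` lies in the kernel iff `Θ_{∅,D}` kills it. [folklore] -/
theorem mem_kerTheta_of_isHomog {D : ℕ} {k : J → P A r} (hk : IsHomog (cdeg J m₀) D k) :
    k ∈ kerTheta ι G m₀ g ↔
      Theta ι G m₀ g ∅ D ⟨ιK A r J k, ⟨ιK_mem_loc_top ∅ k, (projDeg_eq_self_iff _).mp hk⟩⟩ = 0 := by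
  rw [mem_kerTheta_iff]
  constructor
  · intro hK
    have := hK D
    rwa [Theta_congr ι G m₀ g ∅ D (congrArg (ιK A r J) hk) _
      ⟨ιK_mem_loc_top ∅ k, (projDeg_eq_self_iff _).mp hk⟩] at this
  · intro h0 n
    by_cases hn : (n : ℤ) = D
    · have hnD : n = D := by exact_mod_cast hn
      subst hnD
      rw [Theta_congr ι G m₀ g ∅ n (congrArg (ιK A r J) hk) _ ⟨ιK_mem_loc_top ∅ k, (projDeg_eq_self_iff _).mp hk⟩]
      exact h0
    · have h0' : ιK A r J (projDeg (cdeg J m₀) (n : ℤ) k) = 0 := by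
        rw [projDeg_of_isHomog m₀ hk, if_neg hn, map_zero]
      rw [Theta_congr ι G m₀ g ∅ n h0' _ (Submodule.zero_mem _)]
      exact Theta_zero_mk ι G m₀ g ∅ n _

/-- **The kernel is a graded submodule.** [folklore] -/
theorem isGraded_kerTheta : IsGraded (cdeg J m₀) (kerTheta ι G m₀ g) := by
  intro d w hw n
  by_cases h : (n : ℤ) = d
  · subst h
    rw [Theta_congr ι G m₀ g ∅ n (congrArg (ιK A r J) (isHomog_projDeg m₀ (n : ℤ) w)) _
      (ιK_projDeg_mem_locDeg m₀ ∅ n w)]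
    exact hw n
  · have h0 : ιK A r J (projDeg (cdeg J m₀) (n : ℤ) (projDeg (cdeg J m₀) d w)) = 0 := by
      rw [projDeg_projDeg_of_ne m₀ h, map_zero]
    rw [Theta_congr ι G m₀ g ∅ n h0 _ (Submodule.zero_mem _)]
    exact Theta_zero_mk ι G m₀ g ∅ n _

/-! ## `(K_{X_s})_n ⊆ ker Θ_{s,n}` -/

/-- Vectors of `(K_{X_s})_n` lie in `(F_{X_s})_n`. [folklore] -/
theorem mem_Floc_of_mem_locDeg_ker {s : Finset (Fin (r + 1))} {n : ℕ} {v : J → L A r}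
    (hv : v ∈ locDeg (cdeg J m₀) (kerTheta ι G m₀ g) s n) : v ∈ Floc A J m₀ s n :=
  ⟨loc_mono_left le_top s hv.1, hv.2⟩

/-- **`(K_{X_s})_n ⊆ ker Θ_{s,n}`**: if `x_s^N v = ι(k)` with `k ∈ K` then `Θ(k) = 0` globally, hence on
`Z_s`, and `x_s^N / x_i^{N #s}` is a unit there. [folklore] -/
theorem Theta_eq_zero_of_mem_locDeg_ker {s : Finset (Fin (r + 1))} {n : ℕ} {v : J → L A r}
    (hv : v ∈ locDeg (cdeg J m₀) (kerTheta ι G m₀ g) s n) :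
    Theta ι G m₀ g s n ⟨v, mem_Floc_of_mem_locDeg_ker ι G m₀ g hv⟩ = 0 := by
  obtain ⟨⟨N, k, hk, hNv⟩, hdeg⟩ := hv
  have hhom : IsHomog (cdeg J m₀) ((n + N * s.card : ℕ) : ℤ) k := by
    have := isHomog_of_xs_smul_eq m₀ hdeg hNv
    push_cast at this ⊢
    exact this
  have hk0 := (mem_kerTheta_of_isHomog ι G m₀ g hhom).mp hk
  -- restrict to `Z_s`
  have hks : Theta ι G m₀ g s (n + N * s.card) ⟨ιK A r J k, ⟨ιK_mem_loc_top s k, (projDeg_eq_self_iff _).mp hhom⟩⟩ = 0 := by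
    have h := Theta_res ι G m₀ g (Finset.empty_subset s) (n + N * s.card) (ιK A r J k)
      ⟨ιK_mem_loc_top ∅ k, (projDeg_eq_self_iff _).mp hhom⟩
    rw [hk0, map_zero] at h
    exact h
  have hxv : xs A s N • v ∈ Floc A J m₀ s (n + N * s.card) := xs_smul_mem_Floc m₀ N ⟨loc_mono_left le_top s ⟨N, k, hk, hNv⟩, hdeg⟩
  rw [Theta_congr ι G m₀ g s _ hNv.symm _ hxv] at hks
  exact (Theta_xs_smul_eq_zero_iff ι G m₀ g N rfl v _ hxv).mp hks

/-! ## Torsion: sections vanishing on `Z_{s+i}` -/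

omit ι in
/-- Restriction along an equality of opens reflects zero (modules). [folklore] -/
theorem moduleMap_eq_zero_of_eq {W W' V : Z.Opens} (e : W = W') (h : W ≤ V) (h' : W' ≤ V) (y : Γ(G, V))
    (hy : G.presheaf.map (homOfLE h).op y = 0) : G.presheaf.map (homOfLE h').op y = 0 := by
  subst e; exact hy

/-- **Sections of `G` over the affine `Z_i` vanishing on `Z_{s+i}` are killed by a power of
`ū = t_{s,i}|_Z`** for `G` affine-localizing (`Z_{s+i} = D(ū) ⊆ Z_i`). [folklore] -/
theorem exists_pow_smul_eq_zero_of_map_eq_zero [IsAffineHom ι] {G : Z.Modules} (hG : IsAffineLocalizing G)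
    (s : Finset (Fin (r + 1))) (i : Fin (r + 1)) (y : Γ(G, Zop ι {i}))
    (hy : G.presheaf.map (homOfLE (Zop_mono ι (Finset.singleton_subset_iff.mpr (Finset.mem_insert_self i s)))).op y = 0) :
    ∃ m : ℕ, (show Γ(Z, Zop ι {i}) from evalRing ι {i} (tElB A s i)) ^ m • y = 0 := by
  rcases (s.erase i).eq_empty_or_nonempty with hsi | hsi
  · refine ⟨0, ?_⟩
    rw [pow_zero, one_smul]
    have hins : insert i s = {i} := by
      ext a
      simp only [Finset.mem_insert, Finset.mem_singleton]
      refine ⟨?_, fun h => Or.inl h⟩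
      rintro (h | h)
      · exact h
      · by_contra hai
        have : a ∈ s.erase i := Finset.mem_erase.mpr ⟨hai, h⟩
        rw [hsi] at this
        exact absurd this (Finset.notMem_empty a)
    have heq : Zop ι (insert i s) = Zop ι {i} := by rw [hins]
    have := moduleMap_eq_zero_of_eq G heq _ le_rfl y hy
    rwa [show homOfLE (le_rfl : Zop ι {i} ≤ Zop ι {i}) = 𝟙 _ from Subsingleton.elim _ _, op_id,
      G.presheaf.map_id] at this
  · have hU : IsAffineOpen (Zop ι {i}) := isAffineOpen_cover ι i
    set f : Γ(Z, Zop ι {i}) := evalRing ι {i} (tElB A s i) with hf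
    have heq : Zop ι (insert i s) = Z.basicOpen f := Zop_insert_eq_basicOpen ι hsi
    have h0 : G.presheaf.map (homOfLE (Z.basicOpen_le f)).op y = 0 := moduleMap_eq_zero_of_eq G heq _ _ y hy
    exact hG.torsion hU f y (Z.basicOpen_le f) le_rfl h0

/-- The twisted function `x_s^M / x_i^{M #s}` on `Z_∅ ∩ Z_i` is the restriction of `ū^M = (t_{s,i}|_Z)^M`.
[folklore] -/
theorem twFun_xs_eq_map_tEl_pow (s : Finset (Fin (r + 1))) (i : Fin (r + 1)) (M : ℕ) :
    twFun ι ∅ i ((M : ℤ) * s.card) (xs A s M) (xs_natCast_mem_Adm ∅ s M) =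
      Z.presheaf.map (homOfLE (inf_le_right : Zop ι ∅ ⊓ Zop ι {i} ≤ Zop ι {i})).op
        ((show Γ(Z, Zop ι {i}) from evalRing ι {i} (tElB A s i)) ^ M) := by
  have hsub : ({i} : Finset (Fin (r + 1))) ⊆ ∅ ∪ {i} := Finset.subset_union_right
  have hb : twB ∅ i ((M : ℤ) * s.card) (xs A s M) (xs_natCast_mem_Adm ∅ s M) =
      ⟨((tElB A s i ^ M : Bsub A r {i}) : L A r), Bsub_mono hsub (tElB A s i ^ M).2⟩ := by
    apply Subtype.ext
    change xs A {i} (-((M : ℤ) * s.card)) * xs A s M = tEl A s i ^ M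
    rw [mul_comm, xs_mul_xs_single_eq_tEl_pow]
  change Sections.res (strZ ι) (inf_le_Zop_union ι ∅ i) (evalRing ι (∅ ∪ {i}) (twB ∅ i _ (xs A s M) _)) =
    Sections.res (strZ ι) inf_le_right (evalRing ι {i} (tElB A s i) ^ M)
  rw [hb, evalRing_res ι hsub, Sections.res_res, map_pow]

/-! ## `ker Θ_{s,n} ⊆ (K_{X_s})_n` -/

/-- **A global section `Θ_{∅,D}(ι k)` vanishing on `Z_s` is killed by `x_s^M` for `M` large**: for every
`i`, `(x_s^M / x_i^{M #s}) · Θ(ι k)_i = 0`. [folklore] -/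
theorem exists_forall_twFun_smul_comp_eq_zero [IsAffineHom ι] (hG : IsAffineLocalizing G)
    (s : Finset (Fin (r + 1))) {D : ℕ} (k : J → L A r) (hk : k ∈ Floc A J m₀ ∅ D)
    (h0 : MSections.res (strZ ι) (twistMod ι G D) (Zop_mono ι (Finset.empty_subset s)) (Theta ι G m₀ g ∅ D ⟨k, hk⟩) = 0) :
    ∃ M₀ : ℕ, ∀ M, M₀ ≤ M → ∀ i,
      twFun ι ∅ i ((M : ℤ) * s.card) (xs A s M) (xs_natCast_mem_Adm ∅ s M) •
        comp ι G (Theta ι G m₀ g ∅ D ⟨k, hk⟩) i = 0 := by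
  classical
  set y := Theta ι G m₀ g ∅ D ⟨k, hk⟩ with hy
  -- for each chart, the restriction of `y_i` to `Z_i` vanishes on `Z_{s+i}`
  have hle : ∀ i : Fin (r + 1), Zop ι {i} ≤ Zop ι ∅ ⊓ Zop ι {i} := fun i =>
    le_inf (Zop_mono ι (Finset.empty_subset _)) le_rfl
  have hvan : ∀ i : Fin (r + 1), G.presheaf.map
      (homOfLE (Zop_mono ι (Finset.singleton_subset_iff.mpr (Finset.mem_insert_self i s)))).op
        (G.presheaf.map (homOfLE (hle i)).op (comp ι G y i)) = 0 := by
    intro i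
    have hc : comp ι G (MSections.res (strZ ι) (twistMod ι G D) (Zop_mono ι (Finset.empty_subset s)) y) i = 0 := by
      rw [h0]; rfl
    rw [MSections.res_apply, comp_map] at hc
    have hle' : Zop ι (insert i s) ≤ Zop ι s ⊓ Zop ι {i} :=
      le_inf (Zop_mono ι (Finset.subset_insert i s)) (Zop_mono ι (Finset.singleton_subset_iff.mpr (Finset.mem_insert_self i s)))
    have := congrArg (G.presheaf.map (homOfLE hle').op) hc
    rw [map_zero, moduleMap_map_apply] at this
    rw [moduleMap_map_apply]
    exact this
  choose m hm using fun i => exists_pow_smul_eq_zero_of_map_eq_zero ι hG s i _ (hvan i)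
  refine ⟨Finset.univ.sup m, fun M hM i => ?_⟩
  have hmi : m i ≤ M := (Finset.le_sup (f := m) (Finset.mem_univ i)).trans hM
  obtain ⟨d, hd⟩ := Nat.exists_eq_add_of_le hmi
  -- `ū^M y' = 0` on `Z_i`
  have h1 : (show Γ(Z, Zop ι {i}) from evalRing ι {i} (tElB A s i)) ^ M •
      G.presheaf.map (homOfLE (hle i)).op (comp ι G y i) = 0 := by
    have := congrArg (fun z => (show Γ(Z, Zop ι {i}) from evalRing ι {i} (tElB A s i)) ^ d • z) (hm i)
    dsimp only at this
    rwa [smul_zero, ← mul_smul, ← pow_add, show d + m i = M by omega] at this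
  -- transfer back to `Z_∅ ∩ Z_i`
  have h2 : comp ι G y i = G.presheaf.map (homOfLE (inf_le_right : Zop ι ∅ ⊓ Zop ι {i} ≤ Zop ι {i})).op
      (G.presheaf.map (homOfLE (hle i)).op (comp ι G y i)) := by
    rw [moduleMap_map_apply]
    exact (MSections.res_self (strZ ι) G (comp ι G y i)).symm
  rw [twFun_xs_eq_map_tEl_pow, h2, ← Scheme.Modules.map_smul, h1, map_zero]

/-- **`ker Θ_{s,n} ⊆ (K_{X_s})_n`** for `ι` affine and `G` affine-localizing: if `v = ι(k)/x_s^N` has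
`Θ_{s,n}(v) = 0`, then `Θ(ι k)` is a global section of `G(D)` vanishing on `Z_s`, so `X_s^M k ∈ K` for `M`
large and `v = ι(X_s^M k)/x_s^{N+M}`. [folklore] -/
theorem mem_locDeg_ker_of_Theta_eq_zero [IsAffineHom ι] (hG : IsAffineLocalizing G) {s : Finset (Fin (r + 1))}
    {n : ℕ} {v : J → L A r} (hv : v ∈ Floc A J m₀ s n) (h0 : Theta ι G m₀ g s n ⟨v, hv⟩ = 0) :
    v ∈ locDeg (cdeg J m₀) (kerTheta ι G m₀ g) s n := by
  obtain ⟨⟨N, k, -, hNv⟩, hdeg⟩ := id hv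
  have hhom : IsHomog (cdeg J m₀) ((n + N * s.card : ℕ) : ℤ) k := by
    have := isHomog_of_xs_smul_eq m₀ hdeg hNv
    push_cast at this ⊢
    exact this
  have hkK : ιK A r J k ∈ Kdeg A r (cdeg J m₀) ((n + N * s.card : ℕ) : ℤ) := (projDeg_eq_self_iff _).mp hhom
  have hk0 : ∀ t : Finset (Fin (r + 1)), ιK A r J k ∈ Floc A J m₀ t (n + N * s.card) :=
    fun t => ⟨ιK_mem_loc_top t k, hkK⟩
  -- `Θ_s(ι k) = Θ_s(x_s^N v) = 0`
  have hxv : xs A s N • v ∈ Floc A J m₀ s (n + N * s.card) := xs_smul_mem_Floc m₀ N hv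
  have hks : Theta ι G m₀ g s (n + N * s.card) ⟨ιK A r J k, hk0 s⟩ = 0 := by
    rw [← Theta_congr ι G m₀ g s _ hNv hxv (hk0 s)]
    exact (Theta_xs_smul_eq_zero_iff ι G m₀ g N rfl v hv hxv).mpr h0
  -- hence the global section `Θ_∅(ι k)` vanishes on `Z_s`
  have hres : MSections.res (strZ ι) (twistMod ι G (n + N * s.card)) (Zop_mono ι (Finset.empty_subset s))
      (Theta ι G m₀ g ∅ (n + N * s.card) ⟨ιK A r J k, hk0 ∅⟩) = 0 := by
    rw [← Theta_res ι G m₀ g (Finset.empty_subset s) (n + N * s.card) (ιK A r J k) (hk0 ∅)]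
    exact hks
  obtain ⟨M, hM⟩ := exists_forall_twFun_smul_comp_eq_zero ι G m₀ g hG s (ιK A r J k) (hk0 ∅) hres
  -- `X_s^M k ∈ K`
  have hk'hom : IsHomog (cdeg J m₀) ((n + N * s.card + M * s.card : ℕ) : ℤ) (Xs A s ^ M • k) := by
    have := isHomog_of_xs_smul_eq m₀ (s := s) (N := M) hkK (xs_smul_ιK s M k)
    push_cast at this ⊢
    exact this
  have hxk : xs A s M • ιK A r J k ∈ Floc A J m₀ ∅ (n + N * s.card + M * s.card) :=
    smul_mem_Floc m₀ (by push_cast; ring) (xs_natCast_mem_Adm ∅ s M) (hk0 ∅)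
  have hk'K : Xs A s ^ M • k ∈ kerTheta ι G m₀ g := by
    rw [mem_kerTheta_of_isHomog ι G m₀ g hk'hom, ← Theta_congr ι G m₀ g ∅ _ (xs_smul_ιK s M k) hxk]
    refine twistMod_ext ι G fun i => ?_
    rw [comp_Theta_smul ι G m₀ g (by push_cast; ring) (xs_natCast_mem_Adm ∅ s M) (ιK A r J k) (hk0 ∅) hxk i,
      hM M le_rfl i]
    rfl
  refine ⟨⟨N + M, Xs A s ^ M • k, hk'K, ?_⟩, hdeg⟩
  rw [Nat.cast_add, xs_add, mul_comm (xs A s (N : ℤ)) (xs A s (M : ℤ)), mul_smul, hNv, xs_smul_ιK]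

end SerreTwist

end Literature.AlgebraicGeometry.Modules

end
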